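import Summits.AnomalousDissipation.AnomalousDissipation.Theorems.SawtoothPulseCascadeK1LocalisedCascadeSlotExpansionTwoBranch
import Summits.AnomalousDissipation.AnomalousDissipation.Theorems.SawtoothPulseCascadeK1LocalisedCascadeSlotFibreSum

/-!
# K1loc, line `Spectral` / SeqCone — helper: THE PER-FIBRE TWO-STRIP ESTIMATE WITH HIGHER-ORDER COMMUTATORS (B3a)

Helper file of the prover lane on the crux `K1LocalisedCascade` (stmt-AnomalousDissipation-19491), route
`SawtoothPulseCascade` (NOTES "T2 FINDING", HANDOFF B3a).  `…SlotFibreSum.tsum_symbol_sq_twoStrip_le_of_band_of_fibre`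
(and `…SlotFibreSumFull`) sum an ABSTRACT per-fibre two-strip estimate over the fibres; `…SlotFibreUngauge` discharges it
with first-order `ω`-moments (enough when `2ρ_N² < γ²`).  Here it is discharged, on the whole parameter box, by
un-gauging (`ungauge_fibre_eq`) and the two-branch step with higher-order commutators
(`tsum_symbol_sq_twoBranch_le_of_expansion`): the errors are `A^± = Σ_{1≤α<r} B^±_α M_α + L W^±` (sup norms of the
derivative multipliers times sup norms of the derivative symbols, plus the order-`r` remainder) and `C = L₂ W₂`.
Result: `tsum_symbol_sq_twoStrip_fibre_le_of_expansion`, in exactly the shape of the abstract hypothesis `hfib`.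
No definitions; no statement about the stub.
[cite: Grafakos2014, Prop. 3.1.2 (5) (coefficients of products, translations and modulations) and Prop. 3.2.7 (3)
(Parseval)] [problem: turb]
-/

-- `Summit.<Summit>.<Problem>`: single-conjunct summit, the duplicate namespace segment is deliberate.
set_option linter.dupNamespace false

noncomputable section

namespace Summit.AnomalousDissipation.AnomalousDissipation.Theorems.SawtoothPulseCascade.K1Slot

open MeasureTheory Set Filter Topology UnitAddTorus Complex
open scoped ComplexConjugate
open Literature.Analysis Literature.Analysis.FunctionSpaces Literature.Analysis.FluidPDE
open Literature.Analysis.FunctionSpaces.Torus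
open Summit.AnomalousDissipation.AnomalousDissipation.Theorems.SawtoothPulseCascade.SpectralLeakage

variable {d : Type*} [Fintype d]

omit [Fintype d] in
/-- Splitting off the `α = 0` term of a sum over `range r`: `Σ_{α<r} f α ≤ f 0 ⊔ 0 + Σ_{1≤α<r} f α` is not needed; we use the
exact identity `Σ_{α<r} f α = (if 0 < r then f 0 else 0) + Σ_{α ∈ Ico 1 r} f α`. [folklore] -/
theorem sum_range_eq_ite_add_sum_Ico (r : ℕ) (f : ℕ → ℝ) :
    ∑ α ∈ Finset.range r, f α = (if 0 < r then f 0 else 0) + ∑ α ∈ Finset.Ico 1 r, f α := by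
  rcases Nat.eq_zero_or_pos r with rfl | hr
  · simp
  · rw [if_pos hr, Finset.range_eq_Ico, ← Finset.sum_eq_sum_Ico_succ_bot hr f]

/-- A weighted coefficient sum with bounded complex weights is at most the bound times the `L²` norm (Parseval). [folklore] -/
theorem sqrt_tsum_norm_sq_mul_le {G : UnitAddTorus d → ℂ} (hG : Continuous G) {c : (d → ℤ) → ℂ} {Mc : ℝ}
    (hc : ∀ k, ‖c k‖ ≤ Mc) :
    Real.sqrt (∑' k, ‖c k‖ ^ 2 * ‖mFourierCoeff G k‖ ^ 2) ≤ Mc * Real.sqrt (∫ x, ‖G x‖ ^ 2) := by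
  have hMc : 0 ≤ Mc := (norm_nonneg _).trans (hc 0)
  have hP := hasSum_sq_mFourierCoeff_of_continuous hG
  have hle : ∀ k, ‖c k‖ ^ 2 * ‖mFourierCoeff G k‖ ^ 2 ≤ Mc ^ 2 * ‖mFourierCoeff G k‖ ^ 2 := fun k =>
    mul_le_mul_of_nonneg_right (pow_le_pow_left₀ (norm_nonneg _) (hc k) 2) (sq_nonneg _)
  have hs : Summable fun k => ‖c k‖ ^ 2 * ‖mFourierCoeff G k‖ ^ 2 :=
    (hP.summable.mul_left (Mc ^ 2)).of_nonneg_of_le (fun k => by positivity) hle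
  calc Real.sqrt (∑' k, ‖c k‖ ^ 2 * ‖mFourierCoeff G k‖ ^ 2) ≤ Real.sqrt (Mc ^ 2 * ∫ x, ‖G x‖ ^ 2) := by
        refine Real.sqrt_le_sqrt ?_
        rw [← hP.tsum_eq, ← tsum_mul_left]
        exact hs.tsum_le_tsum hle (hP.summable.mul_left _)
    _ = Mc * Real.sqrt (∫ x, ‖G x‖ ^ 2) := by
        rw [Real.sqrt_mul' _ (integral_nonneg fun x => by positivity), Real.sqrt_sq hMc]

variable [DecidableEq d]

/-- **The per-fibre two-strip estimate with higher-order commutators** (one fibre `k_i = n`), in the shape of the abstract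
hypothesis `hfib` of `tsum_symbol_sq_twoStrip_le_of_band_of_fibre` / `tsum_symbol_sq_twoStrip_le_of_fibre`.  Data: a smooth
`G` with modes on the fibre; cut-offs `X^±` (`|X^±| ≤ 1`); shifts `b^±`; the un-gauging multipliers
`Θ^± = X^±(x_j) g_n(x_j) e_{b^± e_j}` with derivative multipliers `Θ^±_α` (`α < r`: continuous, summable coefficients,
`𝓕Θ^±_α(q) = (2πi q_j)^α 𝓕Θ^±(q)`, `‖Θ^±_α‖ ≤ B^±_α`, `B^±_0 ≤ 1`, every `Θ⁺_α` disjoint from `Θ⁻`); a fibre symbol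
`m_n = m` on the fibre with derivative symbols `m_α` (`m_0 = m_n`, `‖m_α‖ ≤ M_α` for `α ≥ 1`) and Taylor remainder
`L ρ` of order `r` on the spectra of `Θ^±`; derivative symbols `μ_α` of the squared shifted symbol `m_n(· − b⁺e_j)²`
with remainder `L₂ ρ₂` on the spectrum of `Θ⁺`.  Conclusion:
`Σ' m²|𝓕((X⁺+X⁻)(x_j)·(G∘Φ))|² ≤ (√Σ' m(k−b⁺e_j)²|𝓕G|² + A⁺‖G‖)² + (√Σ' m(k−b⁻e_j)²|𝓕G|² + A⁻‖G‖)² + 2C‖G‖²`,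
`A^± = Σ_{1≤α<r} B^±_α M_α + L Σρ|𝓕Θ^±|`, `C = L₂ Σρ₂|𝓕Θ⁺|`. [cite: Grafakos2014, Prop. 3.1.2 (5) and Prop. 3.2.7 (3)] -/
theorem tsum_symbol_sq_twoStrip_fibre_le_of_expansion {G : UnitAddTorus d → ℂ} {i j : d} (hG : IsSmooth G)
    (hij : i ≠ j) {n : ℤ} (hn : ∀ k, mFourierCoeff G k ≠ 0 → k i = n) (P Xp Xm : ShearProfile)
    (hXp1 : ∀ y, |Xp y| ≤ 1) (hXm1 : ∀ y, |Xm y| ≤ 1) (bp bm : ℤ) (r : ℕ)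
    {Θpd Θmd : ℕ → UnitAddTorus d → ℂ} (hΘpd_c : ∀ α ∈ Finset.range r, Continuous (Θpd α))
    (hΘpd_s : ∀ α ∈ Finset.range r, Summable fun q => ‖mFourierCoeff (Θpd α) q‖)
    (hΘpd : ∀ α ∈ Finset.range r, ∀ q, mFourierCoeff (Θpd α) q = (2 * Real.pi * I * (q j : ℂ)) ^ α *
      mFourierCoeff (fun x : UnitAddTorus d => (Xp.onCircle (x j) : ℂ) * twist P n (x j) * mFourier (Pi.single j bp) x) q)
    (hΘmd_c : ∀ α ∈ Finset.range r, Continuous (Θmd α))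
    (hΘmd_s : ∀ α ∈ Finset.range r, Summable fun q => ‖mFourierCoeff (Θmd α) q‖)
    (hΘmd : ∀ α ∈ Finset.range r, ∀ q, mFourierCoeff (Θmd α) q = (2 * Real.pi * I * (q j : ℂ)) ^ α *
      mFourierCoeff (fun x : UnitAddTorus d => (Xm.onCircle (x j) : ℂ) * twist P n (x j) * mFourier (Pi.single j bm) x) q)
    {Bp Bm : ℕ → ℝ} (hBp : ∀ α ∈ Finset.range r, ∀ x, ‖Θpd α x‖ ≤ Bp α) (hBm : ∀ α ∈ Finset.range r, ∀ x, ‖Θmd α x‖ ≤ Bm α)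
    (hBp0 : Bp 0 ≤ 1) (hBm0 : Bm 0 ≤ 1)
    (hdis : ∀ α ∈ Finset.range r, ∀ x, conj (Θpd α x) *
      ((Xm.onCircle (x j) : ℂ) * twist P n (x j) * mFourier (Pi.single j bm) x) = 0)
    {m mn : (d → ℤ) → ℝ} (hmn : ∀ k, k i = n → mn k = m k) {M : ℝ} (hmnM : ∀ k, |mn k| ≤ M)
    {md μd : ℕ → (d → ℤ) → ℂ} (hmd0 : ∀ k, md 0 k = (mn k : ℂ)) {Mα : ℕ → ℝ}
    (hMα : ∀ α ∈ Finset.range r, ∀ k, ‖md α k‖ ≤ Mα α) {Md : ℝ} (hμd : ∀ α ∈ Finset.range r, ∀ k, ‖μd α k‖ ≤ Md)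
    {ρ ρ₂ : (d → ℤ) → ℝ} {L L₂ : ℝ} (hρ0 : ∀ q, 0 ≤ ρ q) (hρ₂0 : ∀ q, 0 ≤ ρ₂ q) (hL : 0 ≤ L) (hL₂ : 0 ≤ L₂)
    (hT : ∀ k q, mFourierCoeff (fun x : UnitAddTorus d => (Xp.onCircle (x j) : ℂ) * twist P n (x j) *
        mFourier (Pi.single j bp) x) q ≠ 0 ∨ mFourierCoeff (fun x : UnitAddTorus d => (Xm.onCircle (x j) : ℂ) *
        twist P n (x j) * mFourier (Pi.single j bm) x) q ≠ 0 →
      ‖(mn k : ℂ) - ∑ α ∈ Finset.range r, (2 * Real.pi * I * (q j : ℂ)) ^ α * md α (k - q)‖ ≤ L * ρ q)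
    (hT₂ : ∀ k q, mFourierCoeff (fun x : UnitAddTorus d => (Xp.onCircle (x j) : ℂ) * twist P n (x j) *
        mFourier (Pi.single j bp) x) q ≠ 0 →
      ‖((mn (k + Pi.single j (-bp)) ^ 2 : ℝ) : ℂ) - ∑ α ∈ Finset.range r, (2 * Real.pi * I * (q j : ℂ)) ^ α * μd α (k - q)‖ ≤
        L₂ * ρ₂ q)
    (hρp : Summable fun q => ρ q * ‖mFourierCoeff (fun x : UnitAddTorus d => (Xp.onCircle (x j) : ℂ) * twist P n (x j) *
        mFourier (Pi.single j bp) x) q‖)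
    (hρm : Summable fun q => ρ q * ‖mFourierCoeff (fun x : UnitAddTorus d => (Xm.onCircle (x j) : ℂ) * twist P n (x j) *
        mFourier (Pi.single j bm) x) q‖)
    (hρ₂ : Summable fun q => ρ₂ q * ‖mFourierCoeff (fun x : UnitAddTorus d => (Xp.onCircle (x j) : ℂ) * twist P n (x j) *
        mFourier (Pi.single j bp) x) q‖) :
    ∑' k, m k ^ 2 * ‖mFourierCoeff (fun x => ((Xp.onCircle (x j) : ℂ) + Xm.onCircle (x j)) * G (shearMap i j P x)) k‖ ^ 2 ≤
      (Real.sqrt (∑' k, m (k - Pi.single j bp) ^ 2 * ‖mFourierCoeff G k‖ ^ 2) +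
          (∑ α ∈ Finset.Ico 1 r, Bp α * Mα α + L * ∑' q, ρ q * ‖mFourierCoeff (fun x : UnitAddTorus d =>
            (Xp.onCircle (x j) : ℂ) * twist P n (x j) * mFourier (Pi.single j bp) x) q‖) * Real.sqrt (∫ x, ‖G x‖ ^ 2)) ^ 2 +
        (Real.sqrt (∑' k, m (k - Pi.single j bm) ^ 2 * ‖mFourierCoeff G k‖ ^ 2) +
          (∑ α ∈ Finset.Ico 1 r, Bm α * Mα α + L * ∑' q, ρ q * ‖mFourierCoeff (fun x : UnitAddTorus d =>
            (Xm.onCircle (x j) : ℂ) * twist P n (x j) * mFourier (Pi.single j bm) x) q‖) * Real.sqrt (∫ x, ‖G x‖ ^ 2)) ^ 2 +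
        2 * (L₂ * ∑' q, ρ₂ q * ‖mFourierCoeff (fun x : UnitAddTorus d =>
            (Xp.onCircle (x j) : ℂ) * twist P n (x j) * mFourier (Pi.single j bp) x) q‖) * ∫ x, ‖G x‖ ^ 2 := by
  -- the multipliers
  set Θp : UnitAddTorus d → ℂ := fun x => (Xp.onCircle (x j) : ℂ) * twist P n (x j) * mFourier (Pi.single j bp) x
    with hΘp_def
  set Θm : UnitAddTorus d → ℂ := fun x => (Xm.onCircle (x j) : ℂ) * twist P n (x j) * mFourier (Pi.single j bm) x
    with hΘm_def
  have hΘp_smooth : IsSmooth Θp := isSmooth_ungaugeMultiplier P Xp n j bp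
  have hΘm_smooth : IsSmooth Θm := isSmooth_ungaugeMultiplier P Xm n j bm
  have hΘp1 : ∀ x, ‖Θp x‖ ≤ 1 := fun x => norm_ungaugeMultiplier_le P Xp hXp1 n j bp x
  have hΘm1 : ∀ x, ‖Θm x‖ ≤ 1 := fun x => norm_ungaugeMultiplier_le P Xm hXm1 n j bm x
  -- un-gauge both strips
  have hsplit : (fun x => ((Xp.onCircle (x j) : ℂ) + Xm.onCircle (x j)) * G (shearMap i j P x)) =
      fun x => mFourier (Pi.single j (-bp)) x * (Θp x * G x) + mFourier (Pi.single j (-bm)) x * (Θm x * G x) := by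
    have hp := ungauge_fibre_eq hG hn P Xp j bp
    have hm := ungauge_fibre_eq hG hn P Xm j bm
    funext x
    have hp' := congrFun hp x
    have hm' := congrFun hm x
    simp only [Function.comp_apply] at hp' hm'
    simp only [hΘp_def, hΘm_def, add_mul]
    rw [hp', hm']
  -- the two-branch step with higher-order commutators, for the fibre symbol `mn`
  have h2 := tsum_symbol_sq_twoBranch_le_of_expansion (F := G) (Ξp := Θp) (Ξm := Θm) hG.continuous
    hG.rapidDecay_mFourierCoeff.summable_norm hΘp_smooth.continuous hΘp_smooth.rapidDecay_mFourierCoeff.summable_norm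
    hΘp1 hΘm_smooth.continuous hΘm_smooth.rapidDecay_mFourierCoeff.summable_norm hΘm1 (Pi.single j (-bp))
    (Pi.single j (-bm)) j r hΘpd_c hΘpd_s hΘpd hΘmd_c hΘmd_s hΘmd hBp hBm hdis hmnM (md := md) (μd := μd)
    (Md := max Md (Finset.sup' (insert 0 (Finset.range r)) (Finset.insert_nonempty _ _) Mα))
    (fun α hα k => (hMα α hα k).trans ((Finset.le_sup' Mα (Finset.mem_insert_of_mem hα)).trans (le_max_right _ _)))
    (fun α hα k => (hμd α hα k).trans (le_max_left _ _)) hρ0 hρ₂0 hL hL₂ hT hT₂ hρp hρm hρ₂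
  -- symbol conversions on the fibre
  have hH_supp : ∀ k, mFourierCoeff (fun x => ((Xp.onCircle (x j) : ℂ) + Xm.onCircle (x j)) * G (shearMap i j P x)) k ≠ 0 →
      k i = n := by
    intro k hk
    by_contra h
    have hΞ_inv : ∀ (t : UnitAddCircle) (x : UnitAddTorus d),
        ((Xp.onCircle ((x + Pi.single i t : UnitAddTorus d) j) : ℂ) +
            Xm.onCircle ((x + Pi.single i t : UnitAddTorus d) j)) =
          (Xp.onCircle (x j) : ℂ) + Xm.onCircle (x j) := fun t x => by
      simp [Pi.single_eq_of_ne hij.symm]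
    have hψ_supp : ∀ k, mFourierCoeff (G ∘ shearMap i j P) k ≠ 0 → k i = n := by
      intro k' hk'
      by_contra h'
      exact hk' (mFourierCoeff_comp_shearMap_eq_zero_of_apply_not_mem hG.continuous
        hG.rapidDecay_mFourierCoeff.summable_norm hij P (A := {n}) (fun k'' hk'' => not_not.1 fun h'' => hk'' (hn k'' h'')) h')
    exact hk (mFourierCoeff_mul_eq_zero_of_fibre (θ := G ∘ shearMap i j P) hΞ_inv (hG.comp_shearMap i j P) hψ_supp h)
  have hLsum : ∑' k, mn k ^ 2 * ‖mFourierCoeff (fun x => ((Xp.onCircle (x j) : ℂ) + Xm.onCircle (x j)) *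
      G (shearMap i j P x)) k‖ ^ 2 = ∑' k, m k ^ 2 * ‖mFourierCoeff (fun x => ((Xp.onCircle (x j) : ℂ) + Xm.onCircle (x j)) *
      G (shearMap i j P x)) k‖ ^ 2 :=
    tsum_symbol_sq_congr_of_supp fun k hk => by rw [hmn k (hH_supp k hk)]
  have hshift : ∀ (b : ℤ) (k : d → ℤ), k i = n → mn (k + Pi.single j (-b)) = m (k - Pi.single j b) := by
    intro b k hk
    rw [Pi.single_neg, ← sub_eq_add_neg]
    exact hmn _ (by rw [Pi.sub_apply, Pi.single_eq_of_ne hij, sub_zero, hk])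
  -- the `α = 0` terms are the main terms
  have hmain : ∀ b : ℤ, Real.sqrt (∑' k, ‖md 0 (k + Pi.single j (-b))‖ ^ 2 * ‖mFourierCoeff G k‖ ^ 2) =
      Real.sqrt (∑' k, m (k - Pi.single j b) ^ 2 * ‖mFourierCoeff G k‖ ^ 2) := by
    intro b
    congr 1
    have h1 : ∀ k : d → ℤ, ‖md 0 (k + Pi.single j (-b))‖ ^ 2 = mn (k + Pi.single j (-b)) ^ 2 := fun k => by
      rw [hmd0, Complex.norm_real, Real.norm_eq_abs, sq_abs]
    simp_rw [h1]
    exact tsum_symbol_sq_congr_of_supp fun k hk => by rw [hshift b k (hn k hk)]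
  -- the `α ≥ 1` terms
  have hg0 : 0 ≤ Real.sqrt (∫ x, ‖G x‖ ^ 2) := Real.sqrt_nonneg _
  have hrest : ∀ (B : ℕ → ℝ), (∀ α ∈ Finset.range r, 0 ≤ B α) → ∀ b : ℤ,
      ∑ α ∈ Finset.Ico 1 r, B α * Real.sqrt (∑' k, ‖md α (k + Pi.single j (-b))‖ ^ 2 * ‖mFourierCoeff G k‖ ^ 2) ≤
        (∑ α ∈ Finset.Ico 1 r, B α * Mα α) * Real.sqrt (∫ x, ‖G x‖ ^ 2) := by
    intro B hB0 b
    rw [Finset.sum_mul]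
    refine Finset.sum_le_sum fun α hα => ?_
    have hα' : α ∈ Finset.range r := Finset.mem_range.mpr (Finset.mem_Ico.mp hα).2
    rw [mul_assoc]
    exact mul_le_mul_of_nonneg_left (sqrt_tsum_norm_sq_mul_le hG.continuous fun k => hMα α hα' _) (hB0 α hα')
  have hBp0' : ∀ α ∈ Finset.range r, 0 ≤ Bp α := fun α hα => (norm_nonneg _).trans (hBp α hα 0)
  have hBm0' : ∀ α ∈ Finset.range r, 0 ≤ Bm α := fun α hα => (norm_nonneg _).trans (hBm α hα 0)
  -- bound the branch quantities of `h2`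
  have hXle : ∀ (B : ℕ → ℝ) (b : ℤ) (W : ℝ), (∀ α ∈ Finset.range r, 0 ≤ B α) → B 0 ≤ 1 → 0 ≤ W →
      ∑ α ∈ Finset.range r, B α * Real.sqrt (∑' k, ‖md α (k + Pi.single j (-b))‖ ^ 2 * ‖mFourierCoeff G k‖ ^ 2) +
          L * W * Real.sqrt (∫ x, ‖G x‖ ^ 2) ≤
        Real.sqrt (∑' k, m (k - Pi.single j b) ^ 2 * ‖mFourierCoeff G k‖ ^ 2) +
          (∑ α ∈ Finset.Ico 1 r, B α * Mα α + L * W) * Real.sqrt (∫ x, ‖G x‖ ^ 2) := by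
    intro B b W hB0 hB01 hW
    rw [sum_range_eq_ite_add_sum_Ico, add_mul]
    have h1 := hrest B hB0 b
    have h0 : (if 0 < r then B 0 * Real.sqrt (∑' k, ‖md 0 (k + Pi.single j (-b))‖ ^ 2 * ‖mFourierCoeff G k‖ ^ 2) else 0) ≤
        Real.sqrt (∑' k, m (k - Pi.single j b) ^ 2 * ‖mFourierCoeff G k‖ ^ 2) := by
      split_ifs with hr
      · rw [hmain b]
        have hB00 : 0 ≤ B 0 := hB0 0 (Finset.mem_range.mpr hr)
        calc B 0 * Real.sqrt (∑' k, m (k - Pi.single j b) ^ 2 * ‖mFourierCoeff G k‖ ^ 2)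
            ≤ 1 * Real.sqrt (∑' k, m (k - Pi.single j b) ^ 2 * ‖mFourierCoeff G k‖ ^ 2) :=
              mul_le_mul_of_nonneg_right hB01 (Real.sqrt_nonneg _)
          _ = _ := one_mul _
      · exact Real.sqrt_nonneg _
    linarith
  have hWp0 : 0 ≤ ∑' q, ρ q * ‖mFourierCoeff Θp q‖ := tsum_nonneg fun q => mul_nonneg (hρ0 q) (norm_nonneg _)
  have hWm0 : 0 ≤ ∑' q, ρ q * ‖mFourierCoeff Θm q‖ := tsum_nonneg fun q => mul_nonneg (hρ0 q) (norm_nonneg _)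
  have hXp := hXle Bp bp _ hBp0' hBp0 hWp0
  have hXm := hXle Bm bm _ hBm0' hBm0 hWm0
  -- nonnegativity of the branch quantities
  have hXp0 : 0 ≤ ∑ α ∈ Finset.range r, Bp α * Real.sqrt (∑' k, ‖md α (k + Pi.single j (-bp))‖ ^ 2 * ‖mFourierCoeff G k‖ ^ 2) +
      L * (∑' q, ρ q * ‖mFourierCoeff Θp q‖) * Real.sqrt (∫ x, ‖G x‖ ^ 2) :=
    add_nonneg (Finset.sum_nonneg fun α hα => mul_nonneg (hBp0' α hα) (Real.sqrt_nonneg _))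
      (mul_nonneg (mul_nonneg hL hWp0) hg0)
  have hXm0 : 0 ≤ ∑ α ∈ Finset.range r, Bm α * Real.sqrt (∑' k, ‖md α (k + Pi.single j (-bm))‖ ^ 2 * ‖mFourierCoeff G k‖ ^ 2) +
      L * (∑' q, ρ q * ‖mFourierCoeff Θm q‖) * Real.sqrt (∫ x, ‖G x‖ ^ 2) :=
    add_nonneg (Finset.sum_nonneg fun α hα => mul_nonneg (hBm0' α hα) (Real.sqrt_nonneg _))
      (mul_nonneg (mul_nonneg hL hWm0) hg0)
  have hsqp := pow_le_pow_left₀ hXp0 hXp 2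
  have hsqm := pow_le_pow_left₀ hXm0 hXm 2
  rw [hsplit] at hLsum ⊢
  rw [← hLsum]
  exact h2.trans (by linarith)

end Summit.AnomalousDissipation.AnomalousDissipation.Theorems.SawtoothPulseCascade.K1Slot
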